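import Mathlib
import Summits.MatrixMultiplication.MatrixMultiplication.Theorems.SnSubsetDichotomyNoThresholdSubsetTripleExpLeQuad

/-!
# Dyadic peeling: from Freedman-shaped band bounds to the speed-`√n` tail

Stub `stub_dyadic_peel` of line `klr-graded-polynomial-method` (crux
`SnSubsetDichotomy.NoThresholdSubsetTriple`, stmt-MatrixMultiplication-8302): the pure-analysis
half of the (Q)-lemma of the lead's report §2a.

Let `μ` be a finite measure, `S` an arbitrary real function, `r = √n ≥ 1`, and suppose that on
every band `{L ≤ S ≤ 2L}` (`L > 0`) and for every `λ ≥ 0` we have the Freedman-shaped bound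
`μ{L ≤ S ≤ 2L} ≤ exp(−λ x_L + v_L ψ(λ))` with `x_L = cL/r − Kn`, `v_L = C(2L + n)`,
`ψ(λ) = (e^{λβ} − 1 − λβ)/β²`, `β = 2br`.  Then for `A ≥ max(2K/c, 1)` and
`κ = min(c/(8b), c²/(35C))` with `κ A r ≥ log 2`,
`μ{A n r ≤ S} ≤ 2 exp(−κ A r)`.

Proof.
* Cover `{A n r ≤ S}` by the dyadic bands `B_j = {L_j ≤ S ≤ 2 L_j}`, `L_j = 2ʲ A n r`.
* On `B_j` (write `θ = 2ʲ`): `x ≥ cθAn/2`, `v ≤ 3CθAnr`, and for `λβ ≤ 1`,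
  `ψ(λ) ≤ (18/25) λ²` (from `eᵘ − 1 − u ≤ (e − 2)u² ≤ (18/25)u²` on `[0,1]`, a consequence of
  the landed `stub_exp_le_quad`).  Choosing `λ = 25x/(36v)` if admissible and `λ = 1/β`
  otherwise gives the exponent `≤ −κ θ A r ≤ −κ A r (j+1)`.
* Sum the geometric series: `Σ_j ρ^{j+1} = ρ/(1−ρ) ≤ 2ρ` for `ρ = exp(−κAr) ≤ 1/2`.
-/

open MeasureTheory ProbabilityTheory
open scoped BigOperators

namespace Summit.MatrixMultiplication.MatrixMultiplication.Theorems

/-- The calculus fact `eᵘ − 1 − u ≤ (18/25) u²` for `0 ≤ u ≤ 1`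
(from `eᵘ − 1 − u ≤ (e − 2) u²`, i.e. `stub_exp_le_quad` with `b = λ = 1`, and `e − 2 < 0.72`). -/
private lemma exp_sub_one_sub_le {u : ℝ} (hu0 : 0 ≤ u) (hu1 : u ≤ 1) :
    Real.exp u - 1 - u ≤ 18 / 25 * u ^ 2 := by
  have habs : |u| ≤ 1 := by rwa [abs_of_nonneg hu0]
  have h := stub_exp_le_quad 1 1 u one_pos zero_le_one habs
  simp only [one_mul, one_pow, div_one] at h
  have he : Real.exp 1 - 1 - 1 ≤ 18 / 25 := by
    have := Real.exp_one_lt_d9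
    norm_num at this
    linarith
  have h2 := mul_le_mul_of_nonneg_left he (sq_nonneg u)
  linarith

/-- For `β > 0`, `λ ≥ 0` with `λβ ≤ 1`: `(e^{λβ} − 1 − λβ)/β² ≤ (18/25) λ²`. -/
private lemma psi_le {lam β : ℝ} (hβ : 0 < β) (hlam : 0 ≤ lam) (h1 : lam * β ≤ 1) :
    (Real.exp (lam * β) - 1 - lam * β) / β ^ 2 ≤ 18 / 25 * lam ^ 2 := by
  rw [div_le_iff₀ (by positivity)]
  have h := exp_sub_one_sub_le (mul_nonneg hlam hβ.le) h1
  calc Real.exp (lam * β) - 1 - lam * β ≤ 18 / 25 * (lam * β) ^ 2 := h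
    _ = 18 / 25 * lam ^ 2 * β ^ 2 := by ring

/-- The optimised Freedman exponent on one dyadic band `L = θ · A r² r` (`θ ≥ 1`, `r = √n ≥ 1`):
for a suitable `λ ≥ 0`, `−λ x + v ψ(λ) ≤ −κ θ A r`, where `x = cL/r − K r²`, `v = C(2L + r²)`,
`ψ(λ) = (e^{λβ} − 1 − λβ)/β²`, `β = 2br`, and `κ ≤ min(c/(8b), c²/(35C))`. -/
private lemma band_exponent {K c b C A r θ κ : ℝ} (hc : 0 < c) (hb : 0 < b) (hC : 0 < C)
    (hAK : 2 * K / c ≤ A) (hA1 : 1 ≤ A) (hr : 1 ≤ r) (hθ : 1 ≤ θ)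
    (hκ1 : κ ≤ c / (8 * b)) (hκ2 : κ ≤ c ^ 2 / (35 * C)) :
    ∃ lam : ℝ, 0 ≤ lam ∧
      -(lam * (c * (θ * (A * r ^ 2 * r)) / r - K * r ^ 2)) +
          C * (2 * (θ * (A * r ^ 2 * r)) + r ^ 2) *
            ((Real.exp (lam * (2 * b * r)) - 1 - lam * (2 * b * r)) / (2 * b * r) ^ 2)
        ≤ -(κ * A * r * θ) := by
  have hr0 : 0 < r := by linarith
  have hA0 : 0 < A := by linarith
  have hθ0 : 0 < θ := by linarith
  have hβ0 : 0 < 2 * b * r := by positivity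
  have hβne : 2 * b * r ≠ 0 := hβ0.ne'
  have hArθ : 0 < A * r * θ := by positivity
  have hKA : 2 * K ≤ c * A := by
    have h := (div_le_iff₀ hc).1 hAK
    linarith
  -- the linear coefficient `x = cL/r − K r² = (cθA − K) r²` and its lower bound
  have hx_lb : c * θ * A * r ^ 2 / 2 ≤ c * (θ * (A * r ^ 2 * r)) / r - K * r ^ 2 := by
    have h1 : c * (θ * (A * r ^ 2 * r)) / r = c * θ * A * r ^ 2 := by
      rw [div_eq_iff hr0.ne']
      ring
    rw [h1]
    have hcA : 0 ≤ c * A := by positivity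
    have h3 : c * A * 1 ≤ c * A * θ := mul_le_mul_of_nonneg_left hθ hcA
    have h2 : 0 ≤ (c * θ * A - 2 * K) * r ^ 2 := mul_nonneg (by linarith) (sq_nonneg r)
    linarith
  have hx0 : 0 < c * (θ * (A * r ^ 2 * r)) / r - K * r ^ 2 :=
    lt_of_lt_of_le (by positivity) hx_lb
  -- the variance coefficient `v = C(2L + r²)` and its upper bound
  have hv0 : 0 < C * (2 * (θ * (A * r ^ 2 * r)) + r ^ 2) := by positivity
  have hθAr : 1 ≤ θ * A * r :=
    one_le_mul_of_one_le_of_one_le (one_le_mul_of_one_le_of_one_le hθ hA1) hr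
  have hv_ub : C * (2 * (θ * (A * r ^ 2 * r)) + r ^ 2) ≤ 3 * C * θ * A * r ^ 2 * r := by
    have h2 : r ^ 2 * 1 ≤ r ^ 2 * (θ * A * r) := mul_le_mul_of_nonneg_left hθAr (sq_nonneg r)
    have h3 : C * (r ^ 2 * 1) ≤ C * (r ^ 2 * (θ * A * r)) := mul_le_mul_of_nonneg_left h2 hC.le
    linarith
  set x := c * (θ * (A * r ^ 2 * r)) / r - K * r ^ 2
  set v := C * (2 * (θ * (A * r ^ 2 * r)) + r ^ 2)
  -- the quadratic bound on `v ψ(λ)` for admissible `λ`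
  have hψ : ∀ lam : ℝ, 0 ≤ lam → lam * (2 * b * r) ≤ 1 →
      v * ((Real.exp (lam * (2 * b * r)) - 1 - lam * (2 * b * r)) / (2 * b * r) ^ 2)
        ≤ v * (18 / 25 * lam ^ 2) := fun lam h0 h1 =>
    mul_le_mul_of_nonneg_left (psi_le hβ0 h0 h1) hv0.le
  rcases le_or_gt (x * (2 * b * r)) (36 / 25 * v) with hcase | hcase
  · -- Case A: the interior optimum `λ = 25x/(36v)` is admissible
    have hlam0 : 0 ≤ 25 * x / (36 * v) := by positivity
    have hlam1 : 25 * x / (36 * v) * (2 * b * r) ≤ 1 := by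
      rw [div_mul_eq_mul_div, div_le_one (by positivity)]
      linarith
    refine ⟨25 * x / (36 * v), hlam0, ?_⟩
    have hmain : -(25 * x / (36 * v) * x) + v * (18 / 25 * (25 * x / (36 * v)) ^ 2)
        = -(25 * x ^ 2 / (72 * v)) := by
      have hvne : v ≠ 0 := hv0.ne'
      field_simp
      ring
    have hxsq : (c * θ * A * r ^ 2 / 2) ^ 2 ≤ x ^ 2 := pow_le_pow_left₀ (by positivity) hx_lb 2
    have h1 : c ^ 2 * A * r * θ * v ≤ c ^ 2 * A * r * θ * (3 * C * θ * A * r ^ 2 * r) :=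
      mul_le_mul_of_nonneg_left hv_ub (by positivity)
    have h3 : 35 * C * (c * θ * A * r ^ 2 / 2) ^ 2 ≤ 35 * C * x ^ 2 :=
      mul_le_mul_of_nonneg_left hxsq (by positivity)
    have h4 : 0 ≤ C * c ^ 2 * θ ^ 2 * A ^ 2 * r ^ 4 := by positivity
    have hrate : c ^ 2 / (35 * C) * (A * r * θ) ≤ 25 * x ^ 2 / (72 * v) := by
      rw [show c ^ 2 / (35 * C) * (A * r * θ) = c ^ 2 * (A * r * θ) / (35 * C) by ring]
      rw [div_le_div_iff₀ (by positivity) (by positivity)]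
      linarith
    have hmin : κ * (A * r * θ) ≤ c ^ 2 / (35 * C) * (A * r * θ) :=
      mul_le_mul_of_nonneg_right hκ2 hArθ.le
    linarith [hψ _ hlam0 hlam1]
  · -- Case B: the boundary choice `λ = 1/β`
    have hlam0 : 0 ≤ 1 / (2 * b * r) := by positivity
    have hlb : 1 / (2 * b * r) * (2 * b * r) = 1 := one_div_mul_cancel hβne
    refine ⟨1 / (2 * b * r), hlam0, ?_⟩
    -- `(18/25) v λ ≤ x/2`
    have f1 : 18 / 25 * v * (1 / (2 * b * r)) ≤ x / 2 := by
      have h := mul_le_mul_of_nonneg_right hcase.le hlam0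
      rw [mul_assoc x, mul_comm (2 * b * r) (1 / (2 * b * r)), hlb, mul_one] at h
      linarith
    -- `κ θ A r ≤ λ x / 2`
    have f2 : κ * A * r * θ ≤ 1 / (2 * b * r) * (x / 2) := by
      have hk : κ * (8 * b) ≤ c := (le_div_iff₀ (by positivity)).1 hκ1
      have hθAr2 : 0 ≤ θ * A * r ^ 2 := by positivity
      calc κ * A * r * θ = κ * A * r * θ * (1 / (2 * b * r) * (2 * b * r)) := by rw [hlb, mul_one]
        _ = 1 / (2 * b * r) * (κ * (8 * b) / 4 * (θ * A * r ^ 2)) := by ring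
        _ ≤ 1 / (2 * b * r) * (c / 4 * (θ * A * r ^ 2)) := by gcongr
        _ ≤ 1 / (2 * b * r) * (x / 2) := by
            gcongr
            linarith
    have f3 := mul_le_mul_of_nonneg_left f1 hlam0
    nlinarith [hψ _ hlam0 hlb.le, f2, f3]

/-- Dyadic cover: for `t > 0`, `{t ≤ s} ⊆ ⋃ⱼ {2ʲ t ≤ s ≤ 2 · 2ʲ t}`. -/
private lemma subset_iUnion_dyadic {Ω : Type*} (s : Ω → ℝ) {t : ℝ} (ht : 0 < t) :
    {ω | t ≤ s ω} ⊆ ⋃ j : ℕ, {ω | 2 ^ j * t ≤ s ω ∧ s ω ≤ 2 * (2 ^ j * t)} := by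
  intro ω hω
  simp only [Set.mem_setOf_eq] at hω
  have hx : 1 ≤ s ω / t := by rwa [le_div_iff₀ ht, one_mul]
  obtain ⟨j, hj1, hj2⟩ := exists_nat_pow_near hx one_lt_two
  simp only [Set.mem_iUnion, Set.mem_setOf_eq]
  refine ⟨j, (le_div_iff₀ ht).1 hj1, ?_⟩
  have h2 := (div_lt_iff₀ ht).1 hj2
  rw [pow_succ] at h2
  linarith

/-- Summing geometric band bounds under a finite measure: if `μ(B_j) ≤ ρ^{j+1}` with
`0 ≤ ρ ≤ 1/2`, then `μ(⋃ⱼ B_j) ≤ 2ρ` (no measurability needed). -/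
private lemma measureReal_iUnion_le_of_geometric {Ω : Type*} {mΩ : MeasurableSpace Ω}
    (μ : Measure Ω) [IsFiniteMeasure μ] (B : ℕ → Set Ω) {ρ : ℝ} (hρ0 : 0 ≤ ρ) (hρ : ρ ≤ 1 / 2)
    (hB : ∀ j, μ.real (B j) ≤ ρ ^ (j + 1)) :
    μ.real (⋃ j, B j) ≤ 2 * ρ := by
  have hρ1 : ρ < 1 := by linarith
  have hsum : Summable (fun j : ℕ => ρ ^ (j + 1)) := by
    simp_rw [pow_succ]
    exact (summable_geometric_of_lt_one hρ0 hρ1).mul_right ρ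
  have htsum : ∑' j : ℕ, ρ ^ (j + 1) ≤ 2 * ρ := by
    simp_rw [pow_succ]
    rw [tsum_mul_right, tsum_geometric_of_lt_one hρ0 hρ1]
    have h1 : (1 - ρ)⁻¹ ≤ 2 := by
      rw [inv_eq_one_div, div_le_iff₀ (by linarith)]
      linarith
    exact mul_le_mul_of_nonneg_right h1 hρ0
  have h1 : μ (⋃ j, B j) ≤ ∑' j, μ (B j) := measure_iUnion_le B
  have h2 : ∀ j, μ (B j) ≤ ENNReal.ofReal (ρ ^ (j + 1)) := fun j => by
    rw [← ofReal_measureReal (measure_ne_top μ (B j))]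
    exact ENNReal.ofReal_le_ofReal (hB j)
  have h3 : ∑' j, μ (B j) ≤ ENNReal.ofReal (∑' j : ℕ, ρ ^ (j + 1)) := by
    rw [ENNReal.ofReal_tsum_of_nonneg (fun j => by positivity) hsum]
    exact ENNReal.tsum_le_tsum h2
  have h4 : μ (⋃ j, B j) ≤ ENNReal.ofReal (2 * ρ) :=
    h1.trans (h3.trans (ENNReal.ofReal_le_ofReal htsum))
  rw [measureReal_def, ← ENNReal.toReal_ofReal (by positivity : (0 : ℝ) ≤ 2 * ρ)]
  exact ENNReal.toReal_mono ENNReal.ofReal_ne_top h4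

/-- The peeling argument with `r = √n` abstracted (`r ≥ 1`, `n` replaced by `r²`) and
`κ ≤ min(c/(8b), c²/(35C))`, `κ A r ≥ log 2`. -/
private theorem peel_core {Ω : Type*} {mΩ : MeasurableSpace Ω} (μ : Measure Ω) [IsFiniteMeasure μ]
    (S : Ω → ℝ) {K c b C A r κ : ℝ} (hc : 0 < c) (hb : 0 < b) (hC : 0 < C)
    (hAK : 2 * K / c ≤ A) (hA1 : 1 ≤ A) (hr : 1 ≤ r)
    (hκ1 : κ ≤ c / (8 * b)) (hκ2 : κ ≤ c ^ 2 / (35 * C)) (hlog : Real.log 2 ≤ κ * A * r)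
    (hband : ∀ L lam : ℝ, 0 < L → 0 ≤ lam →
      μ.real {ω | L ≤ S ω ∧ S ω ≤ 2 * L} ≤
        Real.exp (-(lam * (c * L / r - K * r ^ 2)) +
          C * (2 * L + r ^ 2) * ((Real.exp (lam * (2 * b * r)) - 1 - lam * (2 * b * r)) /
            (2 * b * r) ^ 2))) :
    μ.real {ω | A * r ^ 2 * r ≤ S ω} ≤ 2 * Real.exp (-(κ * A * r)) := by
  have hr0 : 0 < r := by linarith
  have hA0 : 0 < A := by linarith
  have hlog2 : 0 < Real.log 2 := Real.log_pos one_lt_two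
  have hκAr : 0 < κ * A * r := hlog2.trans_le hlog
  have ht : 0 < A * r ^ 2 * r := by positivity
  -- the geometric ratio `ρ = exp(−κAr) ≤ 1/2`
  have hρ0 : 0 ≤ Real.exp (-(κ * A * r)) := (Real.exp_pos _).le
  have hρ : Real.exp (-(κ * A * r)) ≤ 1 / 2 := by
    calc Real.exp (-(κ * A * r)) ≤ Real.exp (-Real.log 2) := Real.exp_le_exp.2 (neg_le_neg hlog)
      _ = 1 / 2 := by rw [Real.exp_neg, Real.exp_log two_pos, one_div]
  -- the per-band bound
  have hB : ∀ j : ℕ, μ.real {ω | 2 ^ j * (A * r ^ 2 * r) ≤ S ω ∧ S ω ≤ 2 * (2 ^ j * (A * r ^ 2 * r))}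
      ≤ Real.exp (-(κ * A * r)) ^ (j + 1) := by
    intro j
    have hθ : (1 : ℝ) ≤ 2 ^ j := one_le_pow₀ one_le_two
    obtain ⟨lam, hlam, hexp⟩ := band_exponent hc hb hC hAK hA1 hr hθ hκ1 hκ2
    have h1 := hband (2 ^ j * (A * r ^ 2 * r)) lam (by positivity) hlam
    refine h1.trans ?_
    rw [← Real.exp_nat_mul, Real.exp_le_exp]
    refine hexp.trans ?_
    have hj : (j : ℝ) + 1 ≤ 2 ^ j := by exact_mod_cast (Nat.lt_two_pow_self : j < 2 ^ j)
    have h2 := mul_le_mul_of_nonneg_left hj hκAr.le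
    push_cast
    linarith
  calc μ.real {ω | A * r ^ 2 * r ≤ S ω}
      ≤ μ.real (⋃ j : ℕ, {ω | 2 ^ j * (A * r ^ 2 * r) ≤ S ω ∧ S ω ≤ 2 * (2 ^ j * (A * r ^ 2 * r))}) :=
        measureReal_mono (subset_iUnion_dyadic S ht)
    _ ≤ 2 * Real.exp (-(κ * A * r)) := measureReal_iUnion_le_of_geometric μ _ hρ0 hρ hB

set_option linter.dupNamespace false in
/-- (Q)-LEMMA, peeling half (pure analysis): band bounds of Freedman shape on all dyadic bands
sum to the speed-`√n` tail `μ{A·n^{3/2} ≤ S} ≤ 2·exp(−κ A √n)`, `κ = min(c/(8b), c²/(35C))`,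
for `A ≥ max(2K/c, 1)` and `κA√n ≥ log 2`. [lead c7 report §2a] -/
theorem stub_dyadic_peel {Ω : Type*} {mΩ : MeasurableSpace Ω} (μ : Measure Ω) [IsFiniteMeasure μ]
    (S : Ω → ℝ) (n : ℕ) (hn : 1 ≤ n)
    (K c b C : ℝ) (hc : 0 < c) (hb : 0 < b) (hC : 0 < C)
    (hband : ∀ L lam : ℝ, 0 < L → 0 ≤ lam →
      μ.real {ω | L ≤ S ω ∧ S ω ≤ 2 * L} ≤
        Real.exp (-(lam * (c * L / Real.sqrt n - K * n)) +
          C * (2 * L + n) * ((Real.exp (lam * (2 * b * Real.sqrt n)) - 1 - lam * (2 * b * Real.sqrt n)) /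
            (2 * b * Real.sqrt n) ^ 2)))
    (A : ℝ) (hAK : 2 * K / c ≤ A) (hA1 : 1 ≤ A)
    (hlog : Real.log 2 ≤ min (c / (8 * b)) (c ^ 2 / (35 * C)) * A * Real.sqrt n) :
    μ.real {ω | A * n * Real.sqrt n ≤ S ω} ≤
      2 * Real.exp (-(min (c / (8 * b)) (c ^ 2 / (35 * C)) * A * Real.sqrt n)) := by
  have hn1 : (1 : ℝ) ≤ n := by exact_mod_cast hn
  have hr1 : 1 ≤ Real.sqrt (n : ℝ) := Real.one_le_sqrt.2 hn1
  have hrn : Real.sqrt (n : ℝ) ^ 2 = n := Real.sq_sqrt (by positivity)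
  have key := peel_core μ S hc hb hC hAK hA1 hr1 (min_le_left _ _) (min_le_right _ _) hlog
    (fun L lam hL hlam => by rw [hrn]; exact hband L lam hL hlam)
  rw [hrn] at key
  exact key

end Summit.MatrixMultiplication.MatrixMultiplication.Theorems
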